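import Summits.QuantumFields.BalabanUV.T4Continuum.Spine.NE1p.B7AveragingCurveCommutator

/-!
# T⁴ programme, spine estimate NE1′ (node O3b/H2) — THE ITERATE (43) AT SECOND ORDER: LOCAL derivative data, their
# PROPAGATION through (42) and the rescaling, and the level-`(j+1)` cross-term formula — every level, every field

Cell `pub-balaban-gaps` (YM blitz Y1, track G2), seat `ne1` gen 10 (prover-pub-balaban-gaps-ne1-g10-0); record `HOME/ne/NE1.md`
v10 §6 (xviii) (successor door (b) of gen 9: «the second-order term of the ITERATE (43) … file 9 = its induction step; left: the
bondwise derivative data of the averaged curve (to feed the next level) and the rescaling bookkeeping»).  ADDITIVE — imports this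
seat's `B7AveragingCurveCommutator` (gen 9; through it files 7–8 and the lineages' `B7Prop1Explicit` ∕ `B7Prop2Explicit` ∕
`B7Prop3Flat` BY NAME: `hol`, `stepHol`, `stepA`, `asum`, `bavg`, `gammaWord`, `seg`, `boxVec`, `Xhat`, `Tside`, `rescale`,
`avgIter`, `expCfg`); 0 def.

WHAT THIS FILE PROVES ([folklore] calculus + bookkeeping on the printed objects; 0 sorry).  In a complete normed ℂ-algebra:
* §1 LOCAL DATA.  Gen 9's general-curve `log`-calculus (file 9 §3) asked for bond derivatives at EVERY `t`; the iterate
  needs them only NEAR `t = 0` (the averaged curve is differentiable only where its loops stay inside the radius of (21)).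
  Everything is redone with `∀ᶠ t in 𝓝 0` and with the bond data packaged per bond as
  `∃ v₁ w, (∀ᶠ t, HasDerivAt (V · b) (v₁ t) t) ∧ HasDerivAt v₁ w 0 ∧ v₁ 0 = A(b)` — «`V(t)` is a configuration curve through
  `1`, twice differentiable at `0` bondwise, with VELOCITY FIELD `A`»: inverse letter (`derivData_units_inv_loc`), letters,
  words (`exists_derivData_hol_curve_loc`, velocity `A(Γ)`), the word recursion `iteratedDeriv_two_mlog_hol_curve_cons_loc`,
  and ONE AVERAGING STEP `iteratedDeriv_two_mlog_bavg_curve_loc` (file 9's formula, local hypotheses).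
* §2 PROPAGATION.  `derivData_exp_comp` (local data of `exp ∘ P`), and **`exists_derivData_bavg_curve_loc`: the averaged
  curve `t ↦ Ū_c(V(t))` is again such a curve, with velocity field `X̂_c(A) + A(Γ_c)` (`= T_c(A) = L·Ā_c`, (14), for
  `L ≥ 1`)** — the data the next level of (43) consumes; `val_bavg_curve_zero` (`Ū_c(1) = 1`).
* §3 THE ITERATE.  **`exists_derivData_avgIter`**: at every level `j`, `t ↦ Ū^{j}(V(t))` (the lineage's `avgIter`, rescaled
  to `ℤᵈ` at each level) is such a curve with velocity field the LINEAR ITERATE `(rescale ∘ T)^{j}(A)` (gen 8's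
  `avgIter_expCfg` exponent, now for every field and with no radius hypothesis); and **`iteratedDeriv_two_mlog_avgIter_succ`:
  the level-`(j+1)` quadratic term `d²/dt²|₀ log Ū^{j+1}_c(V(t))` = `Σ_x L^{−d}·κ_j(Γ_{c,x} ∪ (−Γ_c)) + κ_j(Γ_c)
  + [X̂_c(A_j), A_j(Γ_c)]`** with `κ_j(Γ) = d²/dt²|₀ log Ū^{j}(V(t))(Γ)` (unfolded by §1's word recursion down to the
  level-`j` BOND curvatures, i.e. the previous level's output) and `A_j = (rescale ∘ T)^{j}(A)` — the recursion of (43) at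
  second order, closed.
* The STRUCTURAL consequence («the quadratic term of every level of (43) along `e^{tA}` lies in the `ℂ`-span of the pairwise
  commutators of the values of `A`», abelian corollary) is the sibling file `B7AveragingIterateCommutatorSpan` (gen 10).
What it does NOT do: any ESTIMATE, Proposition 4's covariant version (121)∕(127) at a background, the RG densities.

HONEST FRAMING.  [folklore] calculus and bookkeeping; nothing of Bałaban's asserted; NE1′ NOT proved; spine 0∕9; (B) 0∕13;
binders 0∕6; one fixed finite T⁴ — NOT ℝ⁴, NOT infinite volume, NOT a mass gap, NOT Clay.
-/

noncomputable section

open scoped Topology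
open NormedSpace Filter

namespace Summit.QuantumFields.BalabanUV.T4Continuum.NE1p.B7AveragingCommutator

open Literature.MathematicalPhysics.QuantumFieldTheory.Balaban1983to89.MatrixLog (mlog mlog_one)
open Literature.MathematicalPhysics.QuantumFieldTheory.Balaban1983to89.B7Prop1Explicit
open Literature.MathematicalPhysics.QuantumFieldTheory.Balaban1983to89.B7Prop2Explicit (rescale rescale_apply avgIter)
open Literature.MathematicalPhysics.QuantumFieldTheory.Balaban1983to89.B7Prop3Flat (expCfg)
open Literature.MathematicalPhysics.QuantumFieldTheory.Balaban1983to89.B7Prop3GeneralRotated (expCfg_zero)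
open Literature.MathematicalPhysics.QuantumFieldTheory.Balaban1983to89.B8Ineq130 (hol_one)

variable {𝔸 : Type*} [NormedRing 𝔸] [NormedAlgebra ℂ 𝔸] [CompleteSpace 𝔸]

/-! ## §1 Local derivative data (`∀ᶠ t in 𝓝 0`) -/

/-- LOCAL derivative data of the inverse curve: for a units-valued `γ` with `γ(0) = 1`, derivative `γ₁` NEAR `0` and
`γ₁′(0) = w`: `(γ⁻¹)′ = −γ⁻¹γ₁γ⁻¹` near `0` (Mathlib `hasFDerivAt_ringInverse`), this function has derivative
`2γ₁(0)² − w` at `0`, and its value at `0` is `−γ₁(0)` (file 9's `derivData_units_inv` with `∀ t` weakened to `∀ᶠ t`).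
[folklore] -/
theorem derivData_units_inv_loc {γ : ℂ → 𝔸ˣ} {γ₁ : ℂ → 𝔸} {w : 𝔸} (h0 : γ 0 = 1)
    (hγ : ∀ᶠ t in 𝓝 (0 : ℂ), HasDerivAt (fun u : ℂ => ((γ u : 𝔸ˣ) : 𝔸)) (γ₁ t) t) (hγ₁ : HasDerivAt γ₁ w 0) :
    (∀ᶠ t in 𝓝 (0 : ℂ), HasDerivAt (fun u : ℂ => (((γ u)⁻¹ : 𝔸ˣ) : 𝔸))
        (-((((γ t)⁻¹ : 𝔸ˣ) : 𝔸) * γ₁ t * (((γ t)⁻¹ : 𝔸ˣ) : 𝔸))) t)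
      ∧ HasDerivAt (fun t : ℂ => -((((γ t)⁻¹ : 𝔸ˣ) : 𝔸) * γ₁ t * (((γ t)⁻¹ : 𝔸ˣ) : 𝔸)))
          (γ₁ 0 * γ₁ 0 + γ₁ 0 * γ₁ 0 - w) 0
      ∧ -((((γ 0)⁻¹ : 𝔸ˣ) : 𝔸) * γ₁ 0 * (((γ 0)⁻¹ : 𝔸ˣ) : 𝔸)) = -γ₁ 0 := by
  have hinv : ∀ t : ℂ, HasDerivAt (fun u : ℂ => ((γ u : 𝔸ˣ) : 𝔸)) (γ₁ t) t →
      HasDerivAt (fun u : ℂ => (((γ u)⁻¹ : 𝔸ˣ) : 𝔸))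
        (-((((γ t)⁻¹ : 𝔸ˣ) : 𝔸) * γ₁ t * (((γ t)⁻¹ : 𝔸ˣ) : 𝔸))) t := by
    intro t hγt
    have e : (fun u : ℂ => (((γ u)⁻¹ : 𝔸ˣ) : 𝔸)) = fun u : ℂ => Ring.inverse ((γ u : 𝔸ˣ) : 𝔸) := by
      funext u; rw [Ring.inverse_unit]
    rw [e]
    have h := (hasFDerivAt_ringInverse (𝕜 := ℂ) (γ t)).comp_hasDerivAt t hγt
    simpa [Function.comp_def] using h
  have hinv0 := hinv 0 hγ.self_of_nhds
  refine ⟨hγ.mono hinv, ?_, ?_⟩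
  · have h1 : HasDerivAt (fun t : ℂ => (((γ t)⁻¹ : 𝔸ˣ) : 𝔸) * γ₁ t * (((γ t)⁻¹ : 𝔸ˣ) : 𝔸))
        (-((((γ 0)⁻¹ : 𝔸ˣ) : 𝔸) * γ₁ 0 * (((γ 0)⁻¹ : 𝔸ˣ) : 𝔸)) * γ₁ 0 * (((γ 0)⁻¹ : 𝔸ˣ) : 𝔸)
          + (((γ 0)⁻¹ : 𝔸ˣ) : 𝔸) * w * (((γ 0)⁻¹ : 𝔸ˣ) : 𝔸)
          + (((γ 0)⁻¹ : 𝔸ˣ) : 𝔸) * γ₁ 0 * -((((γ 0)⁻¹ : 𝔸ˣ) : 𝔸) * γ₁ 0 * (((γ 0)⁻¹ : 𝔸ˣ) : 𝔸))) 0 := by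
      have := (hinv0.fun_mul hγ₁).fun_mul hinv0
      simpa [add_mul] using this
    have h2 := h1.fun_neg
    rw [h0] at h2
    simp only [inv_one, Units.val_one, one_mul, mul_one] at h2
    have e : -(-γ₁ 0 * γ₁ 0 + w + γ₁ 0 * -γ₁ 0) = γ₁ 0 * γ₁ 0 + γ₁ 0 * γ₁ 0 - w := by noncomm_ring
    rw [e] at h2
    exact h2
  · rw [h0]; simp

/-- `d²/dt²|₀ log γ(t)⁻¹ = −d²/dt²|₀ log γ(t)` under LOCAL data. [cite: Balaban1985Averaging, (9) p.18, (21) p.21] -/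
theorem iteratedDeriv_two_mlog_units_inv_loc {γ : ℂ → 𝔸ˣ} {γ₁ : ℂ → 𝔸} {w : 𝔸} (h0 : γ 0 = 1)
    (hγ : ∀ᶠ t in 𝓝 (0 : ℂ), HasDerivAt (fun u : ℂ => ((γ u : 𝔸ˣ) : 𝔸)) (γ₁ t) t) (hγ₁ : HasDerivAt γ₁ w 0) :
    iteratedDeriv 2 (fun t : ℂ => mlog (((γ t)⁻¹ : 𝔸ˣ) : 𝔸)) 0
      = -iteratedDeriv 2 (fun t : ℂ => mlog ((γ t : 𝔸ˣ) : 𝔸)) 0 := by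
  obtain ⟨hI, hI₁, hI0⟩ := derivData_units_inv_loc h0 hγ hγ₁
  rw [iteratedDeriv_two_mlog_comp (γ := fun t : ℂ => (((γ t)⁻¹ : 𝔸ˣ) : 𝔸)) (by simp [h0]) hI hI₁,
    iteratedDeriv_two_mlog_comp (γ := fun t : ℂ => ((γ t : 𝔸ˣ) : 𝔸)) (by simp [h0]) hγ hγ₁, hI0]
  noncomm_ring

/-- LOCAL derivative data of `exp ∘ P` for a curve `P` with `P(0) = 0`, derivative `P₁` near `0`, `P₁′(0) = w`: derivative
`D exp(P t)(P₁ t)` near `0`, whose derivative at `0` is `P₁(0)² + w` (`D²exp(0)(v,v) + Dexp(0)(w)`, file 7's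
`fderiv_fderiv_exp_zero_apply_self`), and whose value at `0` is `P₁(0)` — the exponential factor of (42) as a curve.
[folklore] -/
theorem derivData_exp_comp {P P₁ : ℂ → 𝔸} {w : 𝔸} (h0 : P 0 = 0)
    (hP : ∀ᶠ t in 𝓝 (0 : ℂ), HasDerivAt P (P₁ t) t) (hP₁ : HasDerivAt P₁ w 0) :
    (∀ᶠ t in 𝓝 (0 : ℂ), HasDerivAt (fun u : ℂ => exp (P u)) (fderiv ℂ (exp : 𝔸 → 𝔸) (P t) (P₁ t)) t)
      ∧ HasDerivAt (fun t : ℂ => fderiv ℂ (exp : 𝔸 → 𝔸) (P t) (P₁ t)) (P₁ 0 * P₁ 0 + w) 0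
      ∧ fderiv ℂ (exp : 𝔸 → 𝔸) (P 0) (P₁ 0) = P₁ 0 := by
  have hα : ∀ᶠ t in 𝓝 (0 : ℂ), HasDerivAt (fun u : ℂ => exp (P u))
      (fderiv ℂ (exp : 𝔸 → 𝔸) (P t) (P₁ t)) t := by
    filter_upwards [hP] with t ht
    have h := ((NormedSpace.exp_analytic (𝕂 := ℂ) (P t)).differentiableAt.hasFDerivAt).comp_hasDerivAt t
      (f := P) ht
    simpa [Function.comp_def] using h
  have hC2 : ContDiffAt ℂ 2 (exp : 𝔸 → 𝔸) (P 0) := (NormedSpace.exp_analytic (𝕂 := ℂ) (P 0)).contDiffAt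
  have hD : HasFDerivAt (fderiv ℂ (exp : 𝔸 → 𝔸)) (fderiv ℂ (fderiv ℂ (exp : 𝔸 → 𝔸)) (P 0)) (P 0) :=
    ((hC2.fderiv_right (m := 1) (by norm_num)).differentiableAt (by norm_num)).hasFDerivAt
  have hc : HasDerivAt (fun t : ℂ => fderiv ℂ (exp : 𝔸 → 𝔸) (P t))
      (fderiv ℂ (fderiv ℂ (exp : 𝔸 → 𝔸)) (P 0) (P₁ 0)) 0 := by
    have := hD.comp_hasDerivAt (0 : ℂ) hP.self_of_nhds
    simpa [Function.comp_def] using this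
  have hα₁ : HasDerivAt (fun t : ℂ => fderiv ℂ (exp : 𝔸 → 𝔸) (P t) (P₁ t))
      (fderiv ℂ (fderiv ℂ (exp : 𝔸 → 𝔸)) (P 0) (P₁ 0) (P₁ 0) + fderiv ℂ (exp : 𝔸 → 𝔸) (P 0) w) 0 :=
    hc.clm_apply hP₁
  rw [h0, fderiv_fderiv_exp_zero_apply_self, (hasFDerivAt_exp_zero (𝕂 := ℂ)).fderiv, one_apply_eq_self] at hα₁
  refine ⟨hα, hα₁, ?_⟩
  rw [h0, (hasFDerivAt_exp_zero (𝕂 := ℂ)).fderiv, one_apply_eq_self]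

section CurveLoc

variable {d : ℕ} {V : ℂ → Site d → Fin d → 𝔸ˣ} {A : Site d → Fin d → 𝔸} (h0 : V 0 = 1)
  (hV : ∀ (y : Site d) (μ : Fin d), ∃ v₁ : ℂ → 𝔸, ∃ w : 𝔸,
    (∀ᶠ t in 𝓝 (0 : ℂ), HasDerivAt (fun u : ℂ => ((V u y μ : 𝔸ˣ) : 𝔸)) (v₁ t) t) ∧ HasDerivAt v₁ w 0 ∧ v₁ 0 = A y μ)

include h0 hV

/-- Local derivative data of ONE LETTER of (9) along a configuration curve through `1` with velocity field `A`: velocity at `0`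
is the signed bond velocity `stepA A`. [cite: Balaban1985Averaging, (9) p.18] -/
theorem exists_derivData_stepHol_loc (x : Site d) (l : Letter d) :
    ∃ α₁ : ℂ → 𝔸, ∃ wa : 𝔸, (∀ᶠ t in 𝓝 (0 : ℂ), HasDerivAt (fun u : ℂ => ((stepHol (V u) x l : 𝔸ˣ) : 𝔸)) (α₁ t) t)
      ∧ HasDerivAt α₁ wa 0 ∧ α₁ 0 = stepA A x l := by
  obtain ⟨μ, b⟩ := l
  cases b
  · obtain ⟨v₁, w, hv, hv₁, hv0⟩ := hV (x - e μ) μ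
    obtain ⟨hI, hI₁, hI0⟩ := derivData_units_inv_loc (γ := fun t : ℂ => V t (x - e μ) μ) (by simp [h0]) hv hv₁
    refine ⟨_, _, ?_, hI₁, by rw [hI0, stepA_false, hv0]⟩
    have e1 : (fun u : ℂ => ((stepHol (V u) x (μ, false) : 𝔸ˣ) : 𝔸)) = fun u : ℂ => (((V u (x - e μ) μ)⁻¹ : 𝔸ˣ) : 𝔸) := by
      funext u; rw [stepHol_false]
    rw [e1]; exact hI
  · obtain ⟨v₁, w, hv, hv₁, hv0⟩ := hV x μ
    refine ⟨v₁, w, ?_, hv₁, by rw [stepA_true, hv0]⟩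
    have e1 : (fun u : ℂ => ((stepHol (V u) x (μ, true) : 𝔸ˣ) : 𝔸)) = fun u : ℂ => ((V u x μ : 𝔸ˣ) : 𝔸) := by
      funext u; rw [stepHol_true]
    rw [e1]; exact hv

/-- **Local derivative data of the word transport** `t ↦ V(t)(Γ)`: a derivative near `0`, differentiable again at `0`, with
velocity `A(Γ)` (the lineage's `asum`). [cite: Balaban1985Averaging, (9) p.18, p.25] -/
theorem exists_derivData_hol_curve_loc :
    ∀ (w : List (Letter d)) (x : Site d), ∃ γ₁ : ℂ → 𝔸, ∃ w₂ : 𝔸,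
      (∀ᶠ t in 𝓝 (0 : ℂ), HasDerivAt (fun u : ℂ => ((hol (V u) x w : 𝔸ˣ) : 𝔸)) (γ₁ t) t)
        ∧ HasDerivAt γ₁ w₂ 0 ∧ γ₁ 0 = asum A x w
  | [], x => by
    refine ⟨fun _ => 0, 0, Filter.Eventually.of_forall fun t => ?_, hasDerivAt_const (0 : ℂ) (0 : 𝔸), by simp⟩
    simpa using hasDerivAt_const t (1 : 𝔸)
  | l :: w, x => by
    obtain ⟨α₁, wa, hα, hα₁, hα0⟩ := exists_derivData_stepHol_loc h0 hV x l
    obtain ⟨β₁, wb, hβ, hβ₁, hβ0⟩ := exists_derivData_hol_curve_loc w (x + l.vec)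
    refine ⟨fun t => α₁ t * ((hol (V t) (x + l.vec) w : 𝔸ˣ) : 𝔸) + ((stepHol (V t) x l : 𝔸ˣ) : 𝔸) * β₁ t,
      wa * ((hol (V 0) (x + l.vec) w : 𝔸ˣ) : 𝔸) + α₁ 0 * β₁ 0 + (α₁ 0 * β₁ 0 + ((stepHol (V 0) x l : 𝔸ˣ) : 𝔸) * wb),
      ?_, ?_, ?_⟩
    · have e1 : (fun u : ℂ => ((hol (V u) x (l :: w) : 𝔸ˣ) : 𝔸))
          = fun u : ℂ => ((stepHol (V u) x l : 𝔸ˣ) : 𝔸) * ((hol (V u) (x + l.vec) w : 𝔸ˣ) : 𝔸) := by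
        funext u; rw [hol_cons, Units.val_mul]
      rw [e1]
      filter_upwards [hα, hβ] with t hat hbt
      exact hat.fun_mul hbt
    · exact (hα₁.fun_mul hβ.self_of_nhds).fun_add (hα.self_of_nhds.fun_mul hβ₁)
    · dsimp only
      rw [asum_cons, hα0, hβ0, val_stepHol_curve_zero h0, one_mul, h0, hol_one, Units.val_one, mul_one]

/-- **THE WORD RECURSION under local data**: `κ(b :: Γ) = κ(letter) + κ(Γ) + [stepA(A)(b), A(Γ)]` with
`κ(·) = d²/dt²|₀ log V(t)(·)`. [cite: Balaban1985Averaging, (9) p.18, (21) p.21, (43) p.24] -/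
theorem iteratedDeriv_two_mlog_hol_curve_cons_loc (x : Site d) (l : Letter d) (w : List (Letter d)) :
    iteratedDeriv 2 (fun t : ℂ => mlog ((hol (V t) x (l :: w) : 𝔸ˣ) : 𝔸)) 0
      = iteratedDeriv 2 (fun t : ℂ => mlog ((stepHol (V t) x l : 𝔸ˣ) : 𝔸)) 0
        + iteratedDeriv 2 (fun t : ℂ => mlog ((hol (V t) (x + l.vec) w : 𝔸ˣ) : 𝔸)) 0
        + (stepA A x l * asum A (x + l.vec) w - asum A (x + l.vec) w * stepA A x l) := by
  obtain ⟨α₁, wa, hα, hα₁, hα0⟩ := exists_derivData_stepHol_loc h0 hV x l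
  obtain ⟨β₁, wb, hβ, hβ₁, hβ0⟩ := exists_derivData_hol_curve_loc h0 hV w (x + l.vec)
  have e1 : (fun t : ℂ => mlog ((hol (V t) x (l :: w) : 𝔸ˣ) : 𝔸))
      = fun t : ℂ => mlog (((stepHol (V t) x l : 𝔸ˣ) : 𝔸) * ((hol (V t) (x + l.vec) w : 𝔸ˣ) : 𝔸)) := by
    funext t; rw [hol_cons, Units.val_mul]
  have hb0 : ((hol (V 0) (x + l.vec) w : 𝔸ˣ) : 𝔸) = 1 := by rw [h0, hol_one, Units.val_one]
  rw [e1, iteratedDeriv_two_mlog_mul (val_stepHol_curve_zero h0 x l) hb0 hα hβ hα₁ hβ₁, hα0, hβ0]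

omit hV in
/-- The reversed letter under LOCAL data of that one bond (`v₁` near `0`, `v₁′(0) = w`): `κ(V(t)(−b)) = −κ(V(t)(b))`.
[cite: Balaban1985Averaging, (9) p.18] -/
theorem iteratedDeriv_two_mlog_stepHol_false_loc {v₁ : ℂ → 𝔸} {w : 𝔸} (x : Site d) (μ : Fin d)
    (hv : ∀ᶠ t in 𝓝 (0 : ℂ), HasDerivAt (fun u : ℂ => ((V u (x - e μ) μ : 𝔸ˣ) : 𝔸)) (v₁ t) t)
    (hv₁ : HasDerivAt v₁ w 0) :
    iteratedDeriv 2 (fun t : ℂ => mlog ((stepHol (V t) x (μ, false) : 𝔸ˣ) : 𝔸)) 0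
      = -iteratedDeriv 2 (fun t : ℂ => mlog ((V t (x - e μ) μ : 𝔸ˣ) : 𝔸)) 0 := by
  have e1 : (fun t : ℂ => mlog ((stepHol (V t) x (μ, false) : 𝔸ˣ) : 𝔸))
      = fun t : ℂ => mlog (((V t (x - e μ) μ)⁻¹ : 𝔸ˣ) : 𝔸) := by
    funext t; rw [stepHol_false]
  rw [e1]
  exact iteratedDeriv_two_mlog_units_inv_loc (γ := fun t : ℂ => V t (x - e μ) μ) (by simp [h0]) hv hv₁

omit [CompleteSpace 𝔸] h0 hV in
/-- The forward letter is the bond curve itself: `κ(V(t)(+b)) = κ(V(t)(b))`. [cite: Balaban1985Averaging, (9) p.18] -/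
theorem iteratedDeriv_two_mlog_stepHol_true (x : Site d) (μ : Fin d) :
    iteratedDeriv 2 (fun t : ℂ => mlog ((stepHol (V t) x (μ, true) : 𝔸ˣ) : 𝔸)) 0
      = iteratedDeriv 2 (fun t : ℂ => mlog ((V t x μ : 𝔸ˣ) : 𝔸)) 0 := by
  simp only [stepHol_true]

omit [CompleteSpace 𝔸] h0 hV in
/-- The empty word has no curvature: `κ(V(t)(∅)) = d²/dt²|₀ log 1 = 0`. [folklore] -/
theorem iteratedDeriv_two_mlog_hol_curve_nil (x : Site d) :
    iteratedDeriv 2 (fun t : ℂ => mlog ((hol (V t) x [] : 𝔸ˣ) : 𝔸)) 0 = 0 := by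
  simp only [hol_nil, Units.val_one, mlog_one, iteratedDeriv_fun_const_zero]

omit hV in
/-- `Ū_c(V(0)) = Ū_c(1) = 1`: the averaged curve passes through `1` ((42) of the unit configuration). [folklore] -/
theorem val_bavg_curve_zero (L : ℕ) (q : Site d) (κ : Fin d) : ((bavg L (V 0) q κ : 𝔸ˣ) : 𝔸) = 1 := by
  rw [val_bavg_curve_eq]
  simp [h0, hol_one, mlog_one]

/-- **ONE AVERAGING STEP (42) ALONG A CURVE WITH LOCAL DATA** — file 9's `iteratedDeriv_two_mlog_bavg_curve` verbatim under
the local, per-bond hypotheses: `d²/dt²|₀ log Ū_c(V(t)) = Σ_x L^{−d}·κ(Γ_{c,x} ∪ (−Γ_c)) + κ(Γ_c) + [X̂_c(A), A(Γ_c)]`.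
[cite: Balaban1985Averaging, (42)–(43) pp.23–24, (15) p.19] -/
theorem iteratedDeriv_two_mlog_bavg_curve_loc (L : ℕ) (q : Site d) (κ : Fin d) :
    iteratedDeriv 2 (fun t : ℂ => mlog ((bavg L (V t) q κ : 𝔸ˣ) : 𝔸)) 0
      = (∑ r : Fin d → Fin L, (((L : ℝ) ^ d)⁻¹) •
            iteratedDeriv 2 (fun t : ℂ =>
              mlog ((hol (V t) q (gammaWord L κ (boxVec L r) ++ seg κ (-(L : ℤ))) : 𝔸ˣ) : 𝔸)) 0)
        + iteratedDeriv 2 (fun t : ℂ => mlog ((hol (V t) q (seg κ L) : 𝔸ˣ) : 𝔸)) 0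
        + (Xhat L A q κ * asum A q (seg κ L) - asum A q (seg κ L) * Xhat L A q κ) := by
  have hw0 : ∀ w : List (Letter d), ((hol (V 0) q w : 𝔸ˣ) : 𝔸) = 1 := fun w => by rw [h0, hol_one, Units.val_one]
  have hdata : ∀ r : Fin d → Fin L, ∃ F : ℂ → 𝔸, ∃ κ₂ : 𝔸,
      (∀ᶠ t in 𝓝 (0 : ℂ), HasDerivAt (fun u : ℂ =>
          mlog ((hol (V u) q (gammaWord L κ (boxVec L r) ++ seg κ (-(L : ℤ))) : 𝔸ˣ) : 𝔸)) (F t) t)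
        ∧ HasDerivAt F κ₂ 0
        ∧ F 0 = asum A q (gammaWord L κ (boxVec L r) ++ seg κ (-(L : ℤ)))
        ∧ κ₂ = iteratedDeriv 2 (fun t : ℂ =>
              mlog ((hol (V t) q (gammaWord L κ (boxVec L r) ++ seg κ (-(L : ℤ))) : 𝔸ˣ) : 𝔸)) 0 := by
    intro r
    obtain ⟨γ₁, w₂, hγ, hγ₁, hγ0⟩ :=
      exists_derivData_hol_curve_loc h0 hV (gammaWord L κ (boxVec L r) ++ seg κ (-(L : ℤ))) q
    obtain ⟨hF, hF', hF0⟩ := derivData_mlog_comp (hw0 _) hγ hγ₁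
    refine ⟨_, _, hF, hF', by rw [hF0, hγ0], ?_⟩
    rw [iteratedDeriv_two_mlog_comp (hw0 _) hγ hγ₁]
  choose F κ₂ hF hF' hF0 hκ₂ using hdata
  set c : ℝ := ((L : ℝ) ^ d)⁻¹ with hc
  have hP : ∀ᶠ t in 𝓝 (0 : ℂ), HasDerivAt (fun u : ℂ => ∑ r : Fin d → Fin L, c •
      mlog ((hol (V u) q (gammaWord L κ (boxVec L r) ++ seg κ (-(L : ℤ))) : 𝔸ˣ) : 𝔸))
      (∑ r : Fin d → Fin L, c • F r t) t := by
    have hall : ∀ᶠ t in 𝓝 (0 : ℂ), ∀ r : Fin d → Fin L, HasDerivAt (fun u : ℂ =>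
        mlog ((hol (V u) q (gammaWord L κ (boxVec L r) ++ seg κ (-(L : ℤ))) : 𝔸ˣ) : 𝔸)) (F r t) t :=
      Filter.eventually_all.2 hF
    filter_upwards [hall] with t ht
    exact HasDerivAt.fun_sum fun r _ => (ht r).const_smul c
  have hP₁ : HasDerivAt (fun t : ℂ => ∑ r : Fin d → Fin L, c • F r t) (∑ r : Fin d → Fin L, c • κ₂ r) 0 :=
    HasDerivAt.fun_sum fun r _ => (hF' r).const_smul c
  have hP0 : (∑ r : Fin d → Fin L, c •
      mlog ((hol (V 0) q (gammaWord L κ (boxVec L r) ++ seg κ (-(L : ℤ))) : 𝔸ˣ) : 𝔸)) = 0 := by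
    simp [hw0]
  obtain ⟨β₁, wb, hβ, hβ₁, hβ0⟩ := exists_derivData_hol_curve_loc h0 hV (seg κ L) q
  have e : (fun t : ℂ => mlog ((bavg L (V t) q κ : 𝔸ˣ) : 𝔸))
      = fun t : ℂ => mlog (exp (∑ r : Fin d → Fin L, c •
          mlog ((hol (V t) q (gammaWord L κ (boxVec L r) ++ seg κ (-(L : ℤ))) : 𝔸ˣ) : 𝔸))
          * ((hol (V t) q (seg κ L) : 𝔸ˣ) : 𝔸)) := by
    funext t; rw [val_bavg_curve_eq]
  rw [e, iteratedDeriv_two_mlog_exp_mul hP0 hP hP₁ (hw0 _) hβ hβ₁, hβ0]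
  simp only [hF0, hκ₂]
  unfold Xhat
  rfl

/-! ## §2 Propagation: the averaged curve is again a curve with local data, velocity field `X̂(A) + A(Γ_c) = T(A)` -/

/-- **THE AVERAGED CURVE HAS LOCAL DERIVATIVE DATA WITH VELOCITY `X̂_c(A) + A(Γ_c)`**: for every `L`-bond `c = ⟨q, q + Le_κ⟩`,
`t ↦ Ū_c(V(t)) = exp[X_c(V(t))]·V(t)(Γ_c)` has a derivative near `0`, differentiable again at `0`, with velocity
`Σ_x L^{−d} A(Γ_{c,x} ∪ (−Γ_c)) + A(Γ_c)` (`= T_c(A) = L·Ā_c` for `L ≥ 1`, `B7Prop1Explicit.Xhat_eq`): the first-order term is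
r04's (14) (`hasDerivAt_mlog_bavg_expCfg`), now with the SECOND-order differentiability the next level of (43) needs.
[cite: Balaban1985Averaging, (14) p.19, (42)–(43) pp.23–24] -/
theorem exists_derivData_bavg_curve_loc (L : ℕ) (q : Site d) (κ : Fin d) :
    ∃ Φ₁ : ℂ → 𝔸, ∃ Φ₂ : 𝔸, (∀ᶠ t in 𝓝 (0 : ℂ), HasDerivAt (fun u : ℂ => ((bavg L (V u) q κ : 𝔸ˣ) : 𝔸)) (Φ₁ t) t)
      ∧ HasDerivAt Φ₁ Φ₂ 0 ∧ Φ₁ 0 = Xhat L A q κ + asum A q (seg κ L) := by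
  have hw0 : ∀ w : List (Letter d), ((hol (V 0) q w : 𝔸ˣ) : 𝔸) = 1 := fun w => by rw [h0, hol_one, Units.val_one]
  have hdata : ∀ r : Fin d → Fin L, ∃ F : ℂ → 𝔸, ∃ κ₂ : 𝔸,
      (∀ᶠ t in 𝓝 (0 : ℂ), HasDerivAt (fun u : ℂ =>
          mlog ((hol (V u) q (gammaWord L κ (boxVec L r) ++ seg κ (-(L : ℤ))) : 𝔸ˣ) : 𝔸)) (F t) t)
        ∧ HasDerivAt F κ₂ 0 ∧ F 0 = asum A q (gammaWord L κ (boxVec L r) ++ seg κ (-(L : ℤ))) := by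
    intro r
    obtain ⟨γ₁, w₂, hγ, hγ₁, hγ0⟩ :=
      exists_derivData_hol_curve_loc h0 hV (gammaWord L κ (boxVec L r) ++ seg κ (-(L : ℤ))) q
    obtain ⟨hF, hF', hF0⟩ := derivData_mlog_comp (hw0 _) hγ hγ₁
    exact ⟨_, _, hF, hF', by rw [hF0, hγ0]⟩
  choose F κ₂ hF hF' hF0 using hdata
  set c : ℝ := ((L : ℝ) ^ d)⁻¹ with hc
  set P : ℂ → 𝔸 := fun u : ℂ => ∑ r : Fin d → Fin L, c •
      mlog ((hol (V u) q (gammaWord L κ (boxVec L r) ++ seg κ (-(L : ℤ))) : 𝔸ˣ) : 𝔸) with hPdef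
  have hP : ∀ᶠ t in 𝓝 (0 : ℂ), HasDerivAt P (∑ r : Fin d → Fin L, c • F r t) t := by
    have hall : ∀ᶠ t in 𝓝 (0 : ℂ), ∀ r : Fin d → Fin L, HasDerivAt (fun u : ℂ =>
        mlog ((hol (V u) q (gammaWord L κ (boxVec L r) ++ seg κ (-(L : ℤ))) : 𝔸ˣ) : 𝔸)) (F r t) t :=
      Filter.eventually_all.2 hF
    filter_upwards [hall] with t ht
    exact HasDerivAt.fun_sum fun r _ => (ht r).const_smul c
  have hP₁ : HasDerivAt (fun t : ℂ => ∑ r : Fin d → Fin L, c • F r t) (∑ r : Fin d → Fin L, c • κ₂ r) 0 :=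
    HasDerivAt.fun_sum fun r _ => (hF' r).const_smul c
  have hP0 : P 0 = 0 := by simp [hPdef, hw0]
  obtain ⟨hE, hE₁, hE0⟩ := derivData_exp_comp (P₁ := fun t : ℂ => ∑ r : Fin d → Fin L, c • F r t) hP0 hP hP₁
  obtain ⟨β₁, wb, hβ, hβ₁, hβ0⟩ := exists_derivData_hol_curve_loc h0 hV (seg κ L) q
  have e : (fun t : ℂ => ((bavg L (V t) q κ : 𝔸ˣ) : 𝔸)) = fun t : ℂ => exp (P t) * ((hol (V t) q (seg κ L) : 𝔸ˣ) : 𝔸) := by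
    funext t; rw [val_bavg_curve_eq]
  refine ⟨fun t => fderiv ℂ (exp : 𝔸 → 𝔸) (P t) (∑ r : Fin d → Fin L, c • F r t) * ((hol (V t) q (seg κ L) : 𝔸ˣ) : 𝔸)
      + exp (P t) * β₁ t, _, ?_, (hE₁.fun_mul hβ.self_of_nhds).fun_add (hE.self_of_nhds.fun_mul hβ₁), ?_⟩
  · rw [e]
    filter_upwards [hE, hβ] with t het hbt
    exact het.fun_mul hbt
  · dsimp only
    rw [hE0, hw0, hP0, exp_zero, mul_one, one_mul, hβ0]
    simp only [hF0]
    rfl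

end CurveLoc

/-! ## §3 The iterate (43): local data at every level, and the level-`(j+1)` cross-term formula -/

section Iterate

variable {d : ℕ} (L : ℕ)

/-- (43) unfolded one level: `Ū^{j+1}(V)(z, κ) = Ū_{⟨Lz, Lz + Le_κ⟩}(Ū^{j}(V))` (the lineage's `avgIter_succ` + `rescale`).
[cite: Balaban1985Averaging, (43) p.24] -/
theorem avgIter_succ_apply (V : Site d → Fin d → 𝔸ˣ) (j : ℕ) (z : Site d) (κ : Fin d) :
    avgIter L V (j + 1) z κ = bavg L (avgIter L V j) ((L : ℤ) • z) κ := rfl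

/-- `Ū^{j}(1) = 1` at every level. [folklore] -/
theorem avgIter_one : ∀ j : ℕ, avgIter L (1 : Site d → Fin d → 𝔸ˣ) j = 1
  | 0 => rfl
  | j + 1 => by
    funext z κ
    rw [avgIter_succ_apply, avgIter_one j]
    exact Units.ext (val_bavg_curve_zero (V := fun _ : ℂ => (1 : Site d → Fin d → 𝔸ˣ)) rfl L _ κ)

variable {V : ℂ → Site d → Fin d → 𝔸ˣ} {A : Site d → Fin d → 𝔸} (hL : 1 ≤ L) (h0 : V 0 = 1)
  (hV : ∀ (y : Site d) (μ : Fin d), ∃ v₁ : ℂ → 𝔸, ∃ w : 𝔸,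
    (∀ᶠ t in 𝓝 (0 : ℂ), HasDerivAt (fun u : ℂ => ((V u y μ : 𝔸ˣ) : 𝔸)) (v₁ t) t) ∧ HasDerivAt v₁ w 0 ∧ v₁ 0 = A y μ)

include h0 in
/-- The iterated curve passes through `1`: `Ū^{j}(V(0)) = 1`. [folklore] -/
theorem avgIter_curve_zero' (j : ℕ) : avgIter L (V 0) j = 1 := by rw [h0, avgIter_one]

include hL h0 hV

/-- **LOCAL DERIVATIVE DATA AT EVERY LEVEL OF (43)**: `t ↦ Ū^{j}(V(t))` is, bond by bond, differentiable near `0` and twice at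
`0`, with VELOCITY FIELD THE LINEAR ITERATE `A_j = (rescale ∘ T)^{j}(A)` (`T_c = L·(14)`; gen 8's `avgIter_expCfg` exponent) —
for EVERY field, with no radius hypothesis (the statement lives at `t → 0`). [cite: Balaban1985Averaging, (14) p.19, (43) p.24] -/
theorem exists_derivData_avgIter :
    ∀ (j : ℕ) (z : Site d) (κ : Fin d), ∃ v₁ : ℂ → 𝔸, ∃ w : 𝔸,
      (∀ᶠ t in 𝓝 (0 : ℂ), HasDerivAt (fun u : ℂ => ((avgIter L (V u) j z κ : 𝔸ˣ) : 𝔸)) (v₁ t) t)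
        ∧ HasDerivAt v₁ w 0 ∧ v₁ 0 = ((fun B => rescale L (Tside L B))^[j] A) z κ
  | 0 => hV
  | j + 1 => by
    intro z κ
    obtain ⟨Φ₁, Φ₂, hΦ, hΦ₁, hΦ0⟩ := exists_derivData_bavg_curve_loc (V := fun t : ℂ => avgIter L (V t) j)
      (avgIter_curve_zero' L h0 j) (exists_derivData_avgIter j) L ((L : ℤ) • z) κ
    refine ⟨Φ₁, Φ₂, hΦ, hΦ₁, ?_⟩
    rw [hΦ0, Function.iterate_succ_apply', rescale_apply, Xhat_eq L hL, sub_add_cancel]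

/-- **THE ITERATE (43) AT SECOND ORDER — the level-`(j+1)` cross-term formula**: for every `L ≥ 1`, every level `j` and every
bond `(z, κ)` of the level-`(j+1)` lattice (its `L`-bond `c = ⟨Lz, Lz + Le_κ⟩` on the level-`j` lattice),
`d²/dt²|₀ log Ū^{j+1}(V(t))(z, κ) = Σ_x L^{−d}·κ_j(Γ_{c,x} ∪ (−Γ_c)) + κ_j(Γ_c) + [X̂_c(A_j), A_j(Γ_c)]`, where
`κ_j(Γ) := d²/dt²|₀ log Ū^{j}(V(t))(Γ)` unfolds by the word recursion (`iteratedDeriv_two_mlog_hol_curve_cons_loc` with the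
level-`j` data of `exists_derivData_avgIter`) down to the level-`j` BOND terms — the previous level's output — and
`A_j = (rescale ∘ T)^{j}(A)`.  The second-order content of (43), recursively closed. [cite: Balaban1985Averaging, (42)–(43) pp.23–24, (15) p.19] -/
theorem iteratedDeriv_two_mlog_avgIter_succ (j : ℕ) (z : Site d) (κ : Fin d) :
    iteratedDeriv 2 (fun t : ℂ => mlog ((avgIter L (V t) (j + 1) z κ : 𝔸ˣ) : 𝔸)) 0
      = (∑ r : Fin d → Fin L, (((L : ℝ) ^ d)⁻¹) •
            iteratedDeriv 2 (fun t : ℂ => mlog ((hol (avgIter L (V t) j) ((L : ℤ) • z)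
              (gammaWord L κ (boxVec L r) ++ seg κ (-(L : ℤ))) : 𝔸ˣ) : 𝔸)) 0)
        + iteratedDeriv 2 (fun t : ℂ => mlog ((hol (avgIter L (V t) j) ((L : ℤ) • z) (seg κ L) : 𝔸ˣ) : 𝔸)) 0
        + (Xhat L (((fun B => rescale L (Tside L B))^[j] A)) ((L : ℤ) • z) κ
              * asum (((fun B => rescale L (Tside L B))^[j] A)) ((L : ℤ) • z) (seg κ L)
            - asum (((fun B => rescale L (Tside L B))^[j] A)) ((L : ℤ) • z) (seg κ L)
              * Xhat L (((fun B => rescale L (Tside L B))^[j] A)) ((L : ℤ) • z) κ) :=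
  iteratedDeriv_two_mlog_bavg_curve_loc (V := fun t : ℂ => avgIter L (V t) j) (avgIter_curve_zero' L h0 j)
    (exists_derivData_avgIter L hL h0 hV j) L ((L : ℤ) • z) κ

end Iterate

end Summit.QuantumFields.BalabanUV.T4Continuum.NE1p.B7AveragingCommutator

end
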